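import Summits.CriticalPhenomena.PercolationContinuityZ3.Theorems.Transplant.FKThreeApexPinned
import HarnessLib

/-!
# Connectivity correlation inequalities for `φ_{w,q}`, `0 < q ≤ 1` — the three-apex monoid: the DISJOINT pair `(u a, bc)` (type T5)
# reduced to the square-root-free form `(U_a)` of the upper-envelope inequality

Helper file (`--supports stmt-CriticalPhenomena-4575`), FK sub-lane `prim-bschramm-fk-3` (gen 14); builds on p205010 (kernel theorem, internal audit
signed; external expert review pending).  Pure real algebra, no sorries; standard axioms.  Memo `bschramm/prim-bschramm-fk-3/DISJOINT-VIA-U.md` §3.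

The pair type T5 of `K_{1,1,1,n}` is the leaf edge `u a` (leaf `u` with remaining edge probabilities `b, c`) against the OPPOSITE triangle edge `bc`
— a disjoint pair, not covered by the adjacent-pair files (`FKThreeApexT4`, `FKThreeApexT2`, `FKThreeApexNegCorrTri`).  Writing `N^{(ab)}, N^{(ac)}`
for the two master forms (`masterN q (swapBC Z)`, `masterN q Z`) and `M_a(Z) := (Z_ab + Z_ac + q Z_0)(Z_ab + Z_ac + Z_1)`, the inequality
`(U_a)` of the memo (`(√N^{(ab)} + √N^{(ac)})² ≥ M_a`) has the square-root-free form
`∀ w₁ w₂ ≥ 0, Φ_a(w₁,w₂)(Z) := (w₁+w₂)(w₁ N^{(ab)} + w₂ N^{(ac)}) − w₁ w₂ M_a ≥ 0` (hypothesis `hU` below; for `N ≥ 0` it is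
equivalent to the square-root form by optimising `w₁/w₂`).  This file proves the EXACT IDENTITY
(**`rayleigh_T5_eq`**, by `ring`)
  `Z¹⁰Z⁰¹ − Z¹¹Z⁰⁰ = t5Form q b c R = q²(1−q)·[ (1−q)·Φ_a(c(1−b), b(1−c))(R) + (q + (1−q)bc)·(c(1−b) N^{(ab)}(R) + b(1−c) N^{(ac)}(R)) ]`
for the four pinned valuations of the pair `(u a, bc)`, hence (**`rayleigh_T5_nonneg_of_UCond`**) the T5 Rayleigh difference is `≥ 0` at every
`R` of the three-apex monoid that satisfies `(U_a)` — the weights `c(1−b)`, `b(1−c)` are the probabilities that the marked leaf attaches to `c` only,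
resp. to `b` only.  That `(U_a)` holds on the whole monoid (all `0 < q ≤ 1`) is the semigroup theorem of the memo (§2, computer-certified; its
formalisation is the next layer); with it, T5 is negative correlation of `u_i a` and `bc` in every weighted `K_{1,1,1,n}`.
[cite: Grimmett2006, §3.9 eq. (3.94) (pp. 63–64)] [folklore]
-/

noncomputable section

namespace Summit.CriticalPhenomena.PercolationContinuityZ3.Theorems

namespace FK

namespace ThreeApex

/-- `M_a(Z) = (Z_ab + Z_ac + q Z_0)(Z_ab + Z_ac + Z_1)`: the product of the `b ≁ c` masses weighted at `a` (memo §1). [folklore] -/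
def massA (q : ℝ) (Z : V5) : ℝ := (Z.zab + Z.zac + q * Z.z0) * (Z.zab + Z.zac + Z.z1)

/-- The square-root-free upper-envelope form `Φ_a(w₁,w₂)(Z) = (w₁+w₂)(w₁ N^{(ab)} + w₂ N^{(ac)}) − w₁ w₂ M_a`. [folklore] -/
def uForm (q w₁ w₂ : ℝ) (Z : V5) : ℝ :=
  (w₁ + w₂) * (w₁ * masterN q (swapBC Z) + w₂ * masterN q Z) - w₁ * w₂ * massA q Z

/-- The T5 Rayleigh form: `q²(1−q)·[(1−q) Φ_a(c(1−b), b(1−c)) + (q + (1−q)bc)(c(1−b) N^{(ab)} + b(1−c) N^{(ac)})]`. [folklore] -/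
def t5Form (q b c : ℝ) (Z : V5) : ℝ :=
  q ^ 2 * (1 - q) * ((1 - q) * uForm q (c * (1 - b)) (b * (1 - c)) Z
    + (q + (1 - q) * b * c) * (c * (1 - b) * masterN q (swapBC Z) + b * (1 - c) * masterN q Z))

/-- **Type T5** (the leaf edge `u a`, leaf with remaining probabilities `b, c`, against the opposite triangle edge `bc`): the Rayleigh difference
`Z¹⁰Z⁰¹ − Z¹¹Z⁰⁰` of the four pinned valuations is the T5 form. [folklore] -/
theorem rayleigh_T5_eq (q b c : ℝ) (R : V5) :
    val q (conv (leaf q 1 b c) (conv (edgeBC 0) R)) * val q (conv (leaf q 0 b c) (conv (edgeBC 1) R)) -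
        val q (conv (leaf q 1 b c) (conv (edgeBC 1) R)) * val q (conv (leaf q 0 b c) (conv (edgeBC 0) R)) =
      t5Form q b c R := by
  simp only [val, conv, leaf, edgeBC, t5Form, uForm, massA, masterN, swapBC, V5.total]
  ring

/-- The T5 form is `≥ 0` wherever `(U_a)` and the two master inequalities hold (`0 ≤ q ≤ 1`, `b, c ∈ [0,1]`). [folklore] -/
theorem t5Form_nonneg_of_UCond {q b c : ℝ} (hq0 : 0 ≤ q) (hq1 : q ≤ 1) (hb0 : 0 ≤ b) (hb1 : b ≤ 1) (hc0 : 0 ≤ c) (hc1 : c ≤ 1)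
    {Z : V5} (hU : ∀ w₁ w₂ : ℝ, 0 ≤ w₁ → 0 ≤ w₂ → 0 ≤ uForm q w₁ w₂ Z) (hNab : 0 ≤ masterN q (swapBC Z)) (hNac : 0 ≤ masterN q Z) : 0 ≤ t5Form q b c Z := by
  have hb' : 0 ≤ 1 - b := sub_nonneg.2 hb1
  have hc' : 0 ≤ 1 - c := sub_nonneg.2 hc1
  have hq' : 0 ≤ 1 - q := sub_nonneg.2 hq1
  have hw₁ : 0 ≤ c * (1 - b) := mul_nonneg hc0 hb'
  have hw₂ : 0 ≤ b * (1 - c) := mul_nonneg hb0 hc'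
  have hΦ : 0 ≤ uForm q (c * (1 - b)) (b * (1 - c)) Z := hU _ _ hw₁ hw₂
  have hκ : 0 ≤ q + (1 - q) * b * c := by positivity
  have hL : 0 ≤ c * (1 - b) * masterN q (swapBC Z) + b * (1 - c) * masterN q Z := by positivity
  unfold t5Form
  positivity

/-- T5 on the monoid, conditional on `(U_a)` at `R`: the pinned Rayleigh difference is `≥ 0`. [folklore] -/
theorem rayleigh_T5_nonneg_of_UCond {q b c : ℝ} (hq0 : 0 ≤ q) (hq1 : q ≤ 1) (hb0 : 0 ≤ b) (hb1 : b ≤ 1) (hc0 : 0 ≤ c) (hc1 : c ≤ 1)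
    {R : V5} (hR : InK q R) (hU : ∀ w₁ w₂ : ℝ, 0 ≤ w₁ → 0 ≤ w₂ → 0 ≤ uForm q w₁ w₂ R) :
    0 ≤ val q (conv (leaf q 1 b c) (conv (edgeBC 0) R)) * val q (conv (leaf q 0 b c) (conv (edgeBC 1) R)) -
        val q (conv (leaf q 1 b c) (conv (edgeBC 1) R)) * val q (conv (leaf q 0 b c) (conv (edgeBC 0) R)) := by
  rw [rayleigh_T5_eq]
  exact t5Form_nonneg_of_UCond hq0 hq1 hb0 hb1 hc0 hc1 hU (hR.swapBC.masterN_nonneg hq0 hq1) (hR.masterN_nonneg hq0 hq1)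

end ThreeApex

end FK

end Summit.CriticalPhenomena.PercolationContinuityZ3.Theorems
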